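import Summits.QuantumFields.YangMills.Theorems.FradkinShenkerFlowStrongPinningPoincareHeatBath

/-!
# Spectral gap of the random-scan heat bath from decay of iterates

Second file of the abstract part of `StrongPinningPoincare`: elementary Hilbert-space facts for
the heat-bath operators of `HeatBath` — the Dirichlet-form identity
`∫∫ (f x − f(x[i↦e]))² dν_i^x dμ = 2(∫ f² dμ − ∫ f P_i f dμ)`, Cauchy–Schwarz, log-convexity of
`t ↦ ‖T^t f‖²` for a symmetric operator `T`, and the resulting bound
`∫ f (T f) dμ ≤ r ∫ f² dμ` from a decay `‖T^t f‖² ≤ A r^{2t}` (no spectral theorem needed).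
-/

noncomputable section

open MeasureTheory Function Real
open scoped ENNReal

namespace Summit.QuantumFields.YangMills.Theorems.StrongPinningPoincare

namespace HeatBath

/-! ### Cauchy–Schwarz and log-convex sequences -/

section Elementary

variable {α : Type*} [MeasurableSpace α]

/-- The product of two bounded measurable functions is integrable against a finite measure.
[folklore] -/
theorem integrable_mul_of_abs_le (μ : Measure α) [IsFiniteMeasure μ] {u v : α → ℝ}
    (hu : Measurable u) (hv : Measurable v) {Mu Mv : ℝ} (hMu : ∀ x, |u x| ≤ Mu)
    (hMv : ∀ x, |v x| ≤ Mv) : Integrable (fun x => u x * v x) μ := by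
  refine integrable_of_abs_le (hu.mul hv) (C := Mu * Mv) fun x => ?_
  rw [abs_mul]
  exact mul_le_mul (hMu x) (hMv x) (abs_nonneg _) ((abs_nonneg _).trans (hMu x))

/-- **Cauchy–Schwarz** for bounded measurable functions against a finite measure, squared form:
`(∫ u v)² ≤ (∫ u²)(∫ v²)` (discriminant of `t ↦ ∫ (u - t v)² ≥ 0`). [folklore] -/
theorem sq_integral_mul_le (μ : Measure α) [IsFiniteMeasure μ] {u v : α → ℝ} (hu : Measurable u)
    (hv : Measurable v) {Mu Mv : ℝ} (hMu : ∀ x, |u x| ≤ Mu) (hMv : ∀ x, |v x| ≤ Mv) :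
    (∫ x, u x * v x ∂μ) ^ 2 ≤ (∫ x, u x ^ 2 ∂μ) * ∫ x, v x ^ 2 ∂μ := by
  have huv := integrable_mul_of_abs_le μ hu hv hMu hMv
  have hsq_int : ∀ {w : α → ℝ} {Mw : ℝ}, Measurable w → (∀ x, |w x| ≤ Mw) →
      Integrable (fun x => w x ^ 2) μ := fun {w Mw} hw hMw => by
    refine integrable_of_abs_le (hw.pow_const 2) (C := Mw ^ 2) fun x => ?_
    rw [abs_pow]
    exact pow_le_pow_left₀ (abs_nonneg _) (hMw x) 2
  have huu := hsq_int hu hMu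
  have hvv := hsq_int hv hMv
  have hquad : ∀ t : ℝ, 0 ≤ (∫ x, v x ^ 2 ∂μ) * (t * t) + (-2 * ∫ x, u x * v x ∂μ) * t +
      ∫ x, u x ^ 2 ∂μ := fun t => by
    have h0 : 0 ≤ ∫ x, (u x - t * v x) ^ 2 ∂μ := integral_nonneg fun x => sq_nonneg _
    have hexp : ∫ x, (u x - t * v x) ^ 2 ∂μ =
        ∫ x, u x ^ 2 ∂μ - 2 * t * ∫ x, u x * v x ∂μ + t ^ 2 * ∫ x, v x ^ 2 ∂μ := by
      have h1 : ∀ x, (u x - t * v x) ^ 2 = u x ^ 2 - 2 * t * (u x * v x) + t ^ 2 * v x ^ 2 :=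
        fun x => by ring
      simp_rw [h1]
      have i1 : Integrable (fun x => u x ^ 2 - 2 * t * (u x * v x)) μ := huu.sub (huv.const_mul _)
      have i2 : Integrable (fun x => t ^ 2 * v x ^ 2) μ := hvv.const_mul _
      have i3 : Integrable (fun x => 2 * t * (u x * v x)) μ := huv.const_mul _
      rw [integral_add i1 i2, integral_sub huu i3, integral_const_mul, integral_const_mul]
    rw [hexp] at h0
    nlinarith [h0]
  have hd := discrim_le_zero hquad
  rw [discrim] at hd
  nlinarith [hd]

/-- **Ratio monotonicity of a log-convex sequence**: if `0 ≤ b` and `b (t+1)² ≤ b t · b (t+2)`,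
then `b (t+1) · b 1 ≤ b (t+2) · b 0` for all `t`. [folklore] -/
theorem logConvex_ratio {b : ℕ → ℝ} (h0 : ∀ t, 0 ≤ b t)
    (hlc : ∀ t, b (t + 1) ^ 2 ≤ b t * b (t + 2)) : ∀ t, b (t + 1) * b 1 ≤ b (t + 2) * b 0 := by
  intro t
  induction t with
  | zero =>
    have h := hlc 0
    rw [pow_two, mul_comm (b 0)] at h
    exact h
  | succ t ih =>
    -- `b(t+2)² b₁ ≤ b(t+1) b(t+3) b₁ ≤ b(t+3) b(t+2) b₀`
    have h1 : b (t + 2) * (b (t + 2) * b 1) ≤ b (t + 2) * (b (t + 3) * b 0) := by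
      calc b (t + 2) * (b (t + 2) * b 1) = b (t + 2) ^ 2 * b 1 := by ring
        _ ≤ b (t + 1) * b (t + 3) * b 1 := mul_le_mul_of_nonneg_right (hlc (t + 1)) (h0 1)
        _ = b (t + 3) * (b (t + 1) * b 1) := by ring
        _ ≤ b (t + 3) * (b (t + 2) * b 0) := mul_le_mul_of_nonneg_left ih (h0 _)
        _ = b (t + 2) * (b (t + 3) * b 0) := by ring
    rcases (h0 (t + 2)).lt_or_eq with hpos | hzero
    · exact le_of_mul_le_mul_left h1 hpos
    · rw [← hzero, zero_mul]
      exact mul_nonneg (h0 _) (h0 _)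

/-- **Log-convexity bound**: under the same hypotheses `b 1 ^ (t+1) ≤ b 0 ^ t · b (t+1)`.
[folklore] -/
theorem logConvex_pow_le {b : ℕ → ℝ} (h0 : ∀ t, 0 ≤ b t)
    (hlc : ∀ t, b (t + 1) ^ 2 ≤ b t * b (t + 2)) : ∀ t, b 1 ^ (t + 1) ≤ b 0 ^ t * b (t + 1) := by
  intro t
  induction t with
  | zero => simp
  | succ t ih =>
    calc b 1 ^ (t + 2) = b 1 ^ (t + 1) * b 1 := pow_succ _ _
      _ ≤ b 0 ^ t * b (t + 1) * b 1 := mul_le_mul_of_nonneg_right ih (h0 1)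
      _ = b 0 ^ t * (b (t + 1) * b 1) := by ring
      _ ≤ b 0 ^ t * (b (t + 2) * b 0) :=
        mul_le_mul_of_nonneg_left (logConvex_ratio h0 hlc t) (pow_nonneg (h0 0) _)
      _ = b 0 ^ (t + 1) * b (t + 2) := by ring

/-- **Decay forces a one-step contraction** for log-convex sequences: if moreover
`b t ≤ A r^{2t}` for all `t` with `r ≥ 0`, then `b 1 ≤ r² b 0`. [folklore] -/
theorem logConvex_le_sq_mul {b : ℕ → ℝ} (h0 : ∀ t, 0 ≤ b t)
    (hlc : ∀ t, b (t + 1) ^ 2 ≤ b t * b (t + 2)) {A r : ℝ} (hr : 0 ≤ r)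
    (hdec : ∀ t, b t ≤ A * r ^ (2 * t)) : b 1 ≤ r ^ 2 * b 0 := by
  by_contra hcon'
  have hcon : r ^ 2 * b 0 < b 1 := lt_of_not_ge hcon'
  have hb1 : 0 < b 1 := (mul_nonneg (sq_nonneg r) (h0 0)).trans_lt hcon
  -- `b 0 > 0` and `r > 0`
  have hb0 : 0 < b 0 := by
    rcases (h0 0).lt_or_eq with h | h
    · exact h
    · have := logConvex_pow_le h0 hlc 1
      rw [← h] at this
      have : b 1 ^ 2 ≤ 0 := by simpa using this
      nlinarith
  have hrpos : 0 < r := by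
    rcases hr.lt_or_eq with h | h
    · exact h
    · have := hdec 1
      rw [← h] at this
      norm_num at this
      linarith
  -- `q = b₁ / (r² b₀) > 1` and `q^(t+1) ≤ A / b₀`
  set q : ℝ := b 1 / (r ^ 2 * b 0) with hq
  have hden : 0 < r ^ 2 * b 0 := mul_pos (pow_pos hrpos 2) hb0
  have hq1 : 1 < q := by rw [hq, one_lt_div hden]; exact hcon
  have hb1q : b 1 = q * (r ^ 2 * b 0) := by rw [hq, div_mul_cancel₀ _ hden.ne']
  have hbound : ∀ t, q ^ (t + 1) ≤ A / b 0 := fun t => by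
    have h1 := (logConvex_pow_le h0 hlc t).trans
      (mul_le_mul_of_nonneg_left (hdec (t + 1)) (pow_nonneg (h0 0) _))
    rw [hb1q, mul_pow] at h1
    -- `q^(t+1) (r² b₀)^(t+1) ≤ b₀^t A r^(2(t+1))`
    have h2 : (r ^ 2 * b 0) ^ (t + 1) = r ^ (2 * (t + 1)) * b 0 ^ t * b 0 := by
      rw [mul_pow, ← pow_mul, pow_succ]; ring
    rw [h2] at h1
    have h3 : q ^ (t + 1) * b 0 * (r ^ (2 * (t + 1)) * b 0 ^ t) ≤
        A * (r ^ (2 * (t + 1)) * b 0 ^ t) := by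
      calc q ^ (t + 1) * b 0 * (r ^ (2 * (t + 1)) * b 0 ^ t)
          = q ^ (t + 1) * (r ^ (2 * (t + 1)) * b 0 ^ t * b 0) := by ring
        _ ≤ b 0 ^ t * (A * r ^ (2 * (t + 1))) := h1
        _ = A * (r ^ (2 * (t + 1)) * b 0 ^ t) := by ring
    have hpos : 0 < r ^ (2 * (t + 1)) * b 0 ^ t := mul_pos (pow_pos hrpos _) (pow_pos hb0 _)
    have h4 : q ^ (t + 1) * b 0 ≤ A := le_of_mul_le_mul_right h3 hpos
    rwa [le_div_iff₀ hb0]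
  obtain ⟨n, hn⟩ := pow_unbounded_of_one_lt (A / b 0) hq1
  have : q ^ n ≤ q ^ (n + 1) := pow_le_pow_right₀ hq1.le (Nat.le_succ n)
  linarith [hbound n]

end Elementary

/-! ### Symmetric operators: contraction from decay of iterates -/

section Operator

variable {α : Type*} [MeasurableSpace α]

/-- **`L²` contraction from decay**, for a symmetric operator `T` on bounded measurable
functions of a finite measure space: if `T` preserves measurability and bounds, is symmetric
(`∫ (T u) v = ∫ u (T v)`), and the iterates of `f` decay like `∫ (T^t f)² ≤ A r^{2t}`, then
`∫ f (T f) ≤ r ∫ f²`. Proof: `b t = ∫ (T^t f)²` is log-convex by symmetry and Cauchy–Schwarz,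
so `b₁ ≤ r² b₀` (`logConvex_le_sq_mul`), and `∫ f (T f) ≤ √(b₀ b₁)`. [folklore] -/
theorem integral_mul_app_le_of_decay (μ : Measure α) [IsFiniteMeasure μ]
    (T : (α → ℝ) → (α → ℝ)) (hTm : ∀ u : α → ℝ, Measurable u → Measurable (T u))
    (hTb : ∀ (u : α → ℝ) (M : ℝ), (∀ x, |u x| ≤ M) → ∀ x, |T u x| ≤ M)
    (hTs : ∀ (u v : α → ℝ) (Mu Mv : ℝ), Measurable u → Measurable v → (∀ x, |u x| ≤ Mu) →
      (∀ x, |v x| ≤ Mv) → ∫ x, T u x * v x ∂μ = ∫ x, u x * T v x ∂μ)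
    {f : α → ℝ} (hf : Measurable f) {M : ℝ} (hM : ∀ x, |f x| ≤ M) {A r : ℝ} (hr : 0 ≤ r)
    (hdec : ∀ t, ∫ x, (T^[t] f x) ^ 2 ∂μ ≤ A * r ^ (2 * t)) :
    ∫ x, f x * T f x ∂μ ≤ r * ∫ x, f x ^ 2 ∂μ := by
  -- iterates are measurable and bounded by `M`
  have him : ∀ t, Measurable (T^[t] f) := fun t => by
    induction t with
    | zero => exact hf
    | succ t ih => rw [iterate_succ']; exact hTm _ ih
  have hib : ∀ t x, |(T^[t] f) x| ≤ M := fun t => by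
    induction t with
    | zero => exact hM
    | succ t ih => rw [iterate_succ']; exact hTb _ _ ih
  set b : ℕ → ℝ := fun t => ∫ x, (T^[t] f x) ^ 2 ∂μ with hb
  have hb0 : ∀ t, 0 ≤ b t := fun t => integral_nonneg fun x => sq_nonneg _
  -- log-convexity from symmetry and Cauchy–Schwarz
  have hlc : ∀ t, b (t + 1) ^ 2 ≤ b t * b (t + 2) := fun t => by
    have hsym : b (t + 1) = ∫ x, (T^[t] f) x * (T^[t + 2] f) x ∂μ := by
      simp only [hb]
      have e1 : ∀ x, (T^[t + 1] f x) ^ 2 = (T (T^[t] f)) x * (T^[t + 1] f) x := fun x => by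
        rw [pow_two, iterate_succ']
        rfl
      simp_rw [e1]
      rw [hTs _ _ M M (him t) (him (t + 1)) (hib t) (hib (t + 1))]
      simp only [Function.iterate_succ_apply']
    rw [hsym]
    simpa only [hb] using sq_integral_mul_le μ (him t) (him (t + 2)) (hib t) (hib (t + 2))
  have hb1 : b 1 ≤ r ^ 2 * b 0 := logConvex_le_sq_mul hb0 hlc hr hdec
  -- `(∫ f Tf)² ≤ b₀ b₁ ≤ (r b₀)²`
  have hb00 : b 0 = ∫ x, f x ^ 2 ∂μ := by simp [hb]
  have hb11 : b 1 = ∫ x, T f x ^ 2 ∂μ := by simp [hb]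
  have hcs : (∫ x, f x * T f x ∂μ) ^ 2 ≤ b 0 * b 1 := by
    rw [hb00, hb11]
    exact sq_integral_mul_le μ hf (hTm f hf) hM (hTb f M hM)
  have hsq : (∫ x, f x * T f x ∂μ) ^ 2 ≤ (r * b 0) ^ 2 := by
    calc (∫ x, f x * T f x ∂μ) ^ 2 ≤ b 0 * b 1 := hcs
      _ ≤ b 0 * (r ^ 2 * b 0) := mul_le_mul_of_nonneg_left hb1 (hb0 0)
      _ = (r * b 0) ^ 2 := by ring
  rw [← hb00]
  nlinarith [hsq, mul_nonneg hr (hb0 0), hb0 0]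

end Operator

/-! ### The random-scan heat-bath operator `P f = (1/n) ∑ᵢ P_i f` -/

section RandomScan

variable {ι : Type*} [Fintype ι] [DecidableEq ι] {E : Type*} [MeasurableSpace E]
  (lam : Measure E) [IsProbabilityMeasure lam] {V : (ι → E) → ℝ}

/-- `P f` is measurable for measurable `f`. [folklore] -/
theorem measurable_randomScan (hV : Measurable V) {f : (ι → E) → ℝ} (hf : Measurable f) :
    Measurable fun x => (Fintype.card ι : ℝ)⁻¹ *
      ∑ i, ∫ e, f (update x i e) ∂(lam.tilted fun e => V (update x i e)) :=
  (Finset.measurable_sum _ fun i _ => measurable_heatBath lam hV i hf).const_mul _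

/-- `P` is an averaging operator: `|f| ≤ M` implies `|P f| ≤ M`. [folklore] -/
theorem abs_randomScan_le [Nonempty ι] (hV : Measurable V) {B : ℝ} (hB : ∀ x, |V x| ≤ B)
    {f : (ι → E) → ℝ} {M : ℝ} (hM : ∀ x, |f x| ≤ M) (x : ι → E) :
    |(Fintype.card ι : ℝ)⁻¹ * ∑ i, ∫ e, f (update x i e) ∂(lam.tilted fun e => V (update x i e))|
      ≤ M := by
  have hn : (0 : ℝ) < Fintype.card ι := by exact_mod_cast Fintype.card_pos
  rw [abs_mul, abs_inv, abs_of_pos hn]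
  have hsum : |∑ i, ∫ e, f (update x i e) ∂(lam.tilted fun e => V (update x i e))| ≤
      ∑ _i : ι, M := (Finset.abs_sum_le_sum_abs _ _).trans
    (Finset.sum_le_sum fun i _ => abs_heatBath_le lam hV hB x i hM)
  rw [Finset.sum_const, Finset.card_univ, nsmul_eq_mul] at hsum
  calc (Fintype.card ι : ℝ)⁻¹ * |∑ i, ∫ e, f (update x i e) ∂(lam.tilted fun e => V (update x i e))|
      ≤ (Fintype.card ι : ℝ)⁻¹ * (Fintype.card ι * M) :=
        mul_le_mul_of_nonneg_left hsum (inv_nonneg.2 hn.le)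
    _ = M := by field_simp

/-- `P` is symmetric on bounded measurable functions: `∫ (P u) v dμ = ∫ u (P v) dμ`. [folklore] -/
theorem integral_randomScan_mul_comm (hV : Measurable V) {B : ℝ} (hB : ∀ x, |V x| ≤ B)
    {u v : (ι → E) → ℝ} (hu : Measurable u) (hv : Measurable v) {Mu Mv : ℝ}
    (hMu : ∀ x, |u x| ≤ Mu) (hMv : ∀ x, |v x| ≤ Mv) :
    ∫ x, ((Fintype.card ι : ℝ)⁻¹ *
        ∑ i, ∫ e, u (update x i e) ∂(lam.tilted fun e => V (update x i e))) * v x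
        ∂((Measure.pi fun _ : ι => lam).tilted V) =
      ∫ x, u x * ((Fintype.card ι : ℝ)⁻¹ *
        ∑ i, ∫ e, v (update x i e) ∂(lam.tilted fun e => V (update x i e)))
        ∂((Measure.pi fun _ : ι => lam).tilted V) := by
  haveI := isProbabilityMeasure_gibbs lam hV hB
  set μ := (Measure.pi fun _ : ι => lam).tilted V with hμ
  have hint : ∀ (f h : (ι → E) → ℝ) (Mf Mh : ℝ), Measurable f → Measurable h →
      (∀ x, |f x| ≤ Mf) → (∀ x, |h x| ≤ Mh) → ∀ i : ι, Integrable
        (fun x => h x * ∫ e, f (update x i e) ∂(lam.tilted fun e => V (update x i e))) μ :=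
    fun f h Mf Mh hf hh hMf hMh i => integrable_mul_of_abs_le μ hh (measurable_heatBath lam hV i hf)
      hMh (fun x => abs_heatBath_le lam hV hB x i hMf)
  have e1 : ∀ x, ((Fintype.card ι : ℝ)⁻¹ *
      ∑ i, ∫ e, u (update x i e) ∂(lam.tilted fun e => V (update x i e))) * v x =
      (Fintype.card ι : ℝ)⁻¹ *
        ∑ i, v x * ∫ e, u (update x i e) ∂(lam.tilted fun e => V (update x i e)) := fun x => by
    simp only [Finset.mul_sum, Finset.sum_mul]
    exact Finset.sum_congr rfl fun i _ => by ring
  have e2 : ∀ x, u x * ((Fintype.card ι : ℝ)⁻¹ *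
      ∑ i, ∫ e, v (update x i e) ∂(lam.tilted fun e => V (update x i e))) =
      (Fintype.card ι : ℝ)⁻¹ *
        ∑ i, u x * ∫ e, v (update x i e) ∂(lam.tilted fun e => V (update x i e)) := fun x => by
    simp only [Finset.mul_sum]
    exact Finset.sum_congr rfl fun i _ => by ring
  simp_rw [e1, e2]
  rw [integral_const_mul, integral_const_mul, integral_finsetSum _ fun i _ =>
    hint u v Mu Mv hu hv hMu hMv i, integral_finsetSum _ fun i _ => hint v u Mv Mu hv hu hMv hMu i]
  congr 1
  refine Finset.sum_congr rfl fun i _ => ?_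
  exact integral_mul_heatBath_comm lam hV hB i hu hv hMu hMv

/-- `P` preserves the mean: `∫ P f dμ = ∫ f dμ`. [folklore] -/
theorem integral_randomScan [Nonempty ι] (hV : Measurable V) {B : ℝ} (hB : ∀ x, |V x| ≤ B)
    {f : (ι → E) → ℝ} (hf : Measurable f) {M : ℝ} (hM : ∀ x, |f x| ≤ M) :
    ∫ x, (Fintype.card ι : ℝ)⁻¹ *
        ∑ i, ∫ e, f (update x i e) ∂(lam.tilted fun e => V (update x i e))
        ∂((Measure.pi fun _ : ι => lam).tilted V) =
      ∫ x, f x ∂((Measure.pi fun _ : ι => lam).tilted V) := by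
  haveI := isProbabilityMeasure_gibbs lam hV hB
  have hn : (Fintype.card ι : ℝ) ≠ 0 := by exact_mod_cast Fintype.card_ne_zero
  rw [integral_const_mul, integral_finsetSum _ fun i _ => ?_]
  · simp only [integral_heatBath lam hV hB _ hf hM, Finset.sum_const, Finset.card_univ,
      nsmul_eq_mul]
    field_simp
  · exact integrable_of_abs_le (measurable_heatBath lam hV i hf)
      fun x => abs_heatBath_le lam hV hB x i hM

/-- **Dirichlet-form identity, one site**: for bounded measurable `f`,
`∫∫ (f x − f(x[i↦e]))² dν_i^x(e) dμ(x) = 2 (∫ f² dμ − ∫ f (P_i f) dμ)`. [folklore] -/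
theorem integral_integral_sq_sub_eq (hV : Measurable V) {B : ℝ} (hB : ∀ x, |V x| ≤ B) (i : ι)
    {f : (ι → E) → ℝ} (hf : Measurable f) {M : ℝ} (hM : ∀ x, |f x| ≤ M) :
    ∫ x, ∫ e, (f x - f (update x i e)) ^ 2 ∂(lam.tilted fun e => V (update x i e))
        ∂((Measure.pi fun _ : ι => lam).tilted V) =
      2 * (∫ x, f x ^ 2 ∂((Measure.pi fun _ : ι => lam).tilted V) -
        ∫ x, f x * ∫ e, f (update x i e) ∂(lam.tilted fun e => V (update x i e))
          ∂((Measure.pi fun _ : ι => lam).tilted V)) := by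
  haveI := isProbabilityMeasure_gibbs lam hV hB
  set μ := (Measure.pi fun _ : ι => lam).tilted V with hμ
  have hf2m : Measurable fun x => f x ^ 2 := hf.pow_const 2
  have hf2b : ∀ x, |f x ^ 2| ≤ M ^ 2 := fun x => by
    rw [abs_pow]; exact pow_le_pow_left₀ (abs_nonneg _) (hM x) 2
  -- pointwise expansion of the inner integral
  have hpt : ∀ x, ∫ e, (f x - f (update x i e)) ^ 2 ∂(lam.tilted fun e => V (update x i e)) =
      f x ^ 2 - 2 * (f x * ∫ e, f (update x i e) ∂(lam.tilted fun e => V (update x i e))) +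
        ∫ e, f (update x i e) ^ 2 ∂(lam.tilted fun e => V (update x i e)) := fun x => by
    haveI := isProbabilityMeasure_heatBath lam hV hB x i
    have i1 : Integrable (fun e => f (update x i e)) (lam.tilted fun e => V (update x i e)) :=
      integrable_of_abs_le (hf.comp (measurable_update x)) fun e => hM _
    have i2 : Integrable (fun e => f (update x i e) ^ 2) (lam.tilted fun e => V (update x i e)) :=
      integrable_of_abs_le (hf2m.comp (measurable_update x)) fun e => hf2b _
    have h1 : ∀ e, (f x - f (update x i e)) ^ 2 =
        (f x ^ 2 - 2 * f x * f (update x i e)) + f (update x i e) ^ 2 := fun e => by ring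
    simp_rw [h1]
    have i4 : Integrable (fun e => 2 * f x * f (update x i e))
        (lam.tilted fun e => V (update x i e)) := i1.const_mul _
    have i3 : Integrable (fun e => f x ^ 2 - 2 * f x * f (update x i e))
        (lam.tilted fun e => V (update x i e)) := (integrable_const _).sub i4
    rw [integral_add i3 i2, integral_sub (integrable_const _) i4, integral_const_mul]
    simp only [integral_const, probReal_univ, one_smul]
    ring
  simp_rw [hpt]
  have j1 : Integrable (fun x => f x ^ 2) μ := integrable_of_abs_le hf2m hf2b
  have j2 : Integrable (fun x => f x * ∫ e, f (update x i e)
      ∂(lam.tilted fun e => V (update x i e))) μ :=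
    integrable_mul_of_abs_le μ hf (measurable_heatBath lam hV i hf) hM
      fun x => abs_heatBath_le lam hV hB x i hM
  have j3 : Integrable (fun x => ∫ e, f (update x i e) ^ 2
      ∂(lam.tilted fun e => V (update x i e))) μ :=
    integrable_of_abs_le (measurable_heatBath lam hV i hf2m) fun x => abs_heatBath_le lam hV hB x i hf2b
  have k2 : Integrable (fun x => 2 * (f x * ∫ e, f (update x i e)
      ∂(lam.tilted fun e => V (update x i e)))) μ := j2.const_mul _
  have k1 : Integrable (fun x => f x ^ 2 - 2 * (f x * ∫ e, f (update x i e)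
      ∂(lam.tilted fun e => V (update x i e)))) μ := j1.sub k2
  rw [integral_add k1 j3, integral_sub j1 k2, integral_const_mul,
    integral_heatBath lam hV hB i hf2m hf2b]
  ring

/-- **Dirichlet-form identity, random scan**: summing over the sites,
`∑ᵢ ∫∫ (f x − f(x[i↦e]))² dν_i^x dμ = 2 n (∫ f² dμ − ∫ f (P f) dμ)`. [folklore] -/
theorem sum_integral_integral_sq_sub_eq (hV : Measurable V) {B : ℝ} (hB : ∀ x, |V x| ≤ B)
    {f : (ι → E) → ℝ} (hf : Measurable f) {M : ℝ} (hM : ∀ x, |f x| ≤ M) :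
    ∑ i, ∫ x, ∫ e, (f x - f (update x i e)) ^ 2 ∂(lam.tilted fun e => V (update x i e))
        ∂((Measure.pi fun _ : ι => lam).tilted V) =
      2 * (Fintype.card ι : ℝ) * (∫ x, f x ^ 2 ∂((Measure.pi fun _ : ι => lam).tilted V) -
        ∫ x, f x * ((Fintype.card ι : ℝ)⁻¹ *
          ∑ i, ∫ e, f (update x i e) ∂(lam.tilted fun e => V (update x i e)))
          ∂((Measure.pi fun _ : ι => lam).tilted V)) := by
  haveI := isProbabilityMeasure_gibbs lam hV hB
  rcases isEmpty_or_nonempty ι with hι | hι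
  · simp
  have hn : (Fintype.card ι : ℝ) ≠ 0 := by exact_mod_cast Fintype.card_ne_zero
  simp_rw [integral_integral_sq_sub_eq lam hV hB _ hf hM]
  have e2 : ∀ x, f x * ((Fintype.card ι : ℝ)⁻¹ *
      ∑ i, ∫ e, f (update x i e) ∂(lam.tilted fun e => V (update x i e))) =
      (Fintype.card ι : ℝ)⁻¹ *
        ∑ i, f x * ∫ e, f (update x i e) ∂(lam.tilted fun e => V (update x i e)) := fun x => by
    simp only [Finset.mul_sum]
    exact Finset.sum_congr rfl fun i _ => by ring
  simp_rw [e2]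
  rw [integral_const_mul, integral_finsetSum _ fun i _ => ?_]
  · rw [← Finset.mul_sum, Finset.sum_sub_distrib, Finset.sum_const, Finset.card_univ, nsmul_eq_mul]
    field_simp
  · exact integrable_mul_of_abs_le _ hf (measurable_heatBath lam hV i hf) hM
      fun x => abs_heatBath_le lam hV hB x i hM

end RandomScan

end HeatBath

end Summit.QuantumFields.YangMills.Theorems.StrongPinningPoincare

end
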